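import Summits.BirchSwinnertonDyer.BirchSwinnertonDyer.Theorems.ManinLocalTwoThreeManinPrimeToAdditiveFiveLeUpperAnchorOfFacts
import Summits.BirchSwinnertonDyer.BirchSwinnertonDyer.Theorems.EdixhovenFibreFiveSevenStarredOptimalManinUnitFiveSeven
import Summits.BirchSwinnertonDyer.BirchSwinnertonDyer.Theorems.AdditiveKolyvaginRoadManinFrameResidueProperRTameTwistFull
import Literature.NumberTheory.EllipticCurves.IsogenyIdProofs
import HarnessLib

/-!
# Route `ManinLocalTwoThree`, residual crux C5 `ManinPrimeToAdditiveFiveLe`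
# (stmt-BirchSwinnertonDyer-22969), line `upper_anchor`: STUB 3 `stub_upperAnchor`
# GRANTED KATO'S NÉRON INTEGRALITY ALONE (F′ at `p > 7`, F″ at `p ∈ {5, 7}`) — no Edixhoven input

Thin glue (allocation γ′ of the lead bsd-line-ml23-c5-p1, HOME INBOX 2026-08-28T05:59:40Z; kept apart
from the route-independent core `…UpperAnchorOfFacts` because it imports theorem files of the routes
`EdixhovenFibreFiveSeven` and `AdditiveKolyvaginRoad`). The registered signature of `stub_upperAnchor`
(skeleton `Cruxes/ManinPrimeToAdditiveFiveLe/Lines/upper_anchor.lean`) VERBATIM as the conclusion of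

* `upperAnchor_of_kato : F′ → F″ → (stub 3)`, where
  F′ = `kato_neron_isIntegral_twistedSymbolSum_of_additive` (Kato 2004 (8.1.3)/Thm. 9.7 + Kim–Nakamura
  2020 at an additive `p > 7`, cite-only Literature fact) and
  F″ = `kato_neron_isIntegral_twistedSymbolSum_of_additive_five_le` (the same at `p ≥ 5` off the
  Kosters–Pannekoek exception, cite-only).

Proof. `p > 7`: the wall cell's per-curve certificate
`ManinFrameResidueProperRTameTwist.forall_latticeOptimal_not_dvd_c_of_tameTwistL` (p579959 family):
GRANTED F′, a globally minimal curve additive at `p > 7` with `E[p]` irreducible has `p ∤ c` for EVERY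
lattice-optimal conductor-level datum of every globally minimal curve of its class — applied to the
upper member `W'` itself (additive since `p² ∣ N(W') = N(W)`; `W'[p]` irreducible by twist/isomorphism
invariance, `AdditivePotMult.irr_iff_of_model_twist`); the upper-member and degree data of the stub
are not even used. `p ∈ {5, 7}`: the core file's `upperAnchor_fiveSeven_of_starred` fed with crux K★
through `starredOptimalManinUnitFiveSeven_of_kato` (p581141).

Compared with the companion `…UpperAnchorOfKStar` (`upperAnchor_of_edixhovenKodairaFact_of_kato`:
Edixhoven Thm. 3 + F″), this trades Edixhoven 1991 Thm. 3 for Kato's F′ at `p > 7`: stub 3 holds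
GRANTED EITHER {Edixhoven Thm. 3, F″} OR {F′, F″}. Conditional-result (`--supports … --as helper`);
the registered stub stays `sorry` (C5 carries none of these facts). Nothing here proves BSD, Manin's
conjecture or C5. Seat bsd-line-ml23-c5-p1-w2 (width prover).

References: [Kato2004Asterisque] (8.1.3), Thm. 9.7; [KimNakamura2020] Cor. 2.4;
[KostersPannekoek2017] Thm. 1; [EdixhovenManin1991] §1.
-/

set_option autoImplicit false
-- the Theorems namespace of this sub repeats the summit name by design (D-0017 nested layout)
set_option linter.dupNamespace false

noncomputable section

namespace Summit.BirchSwinnertonDyer.BirchSwinnertonDyer.Theorems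

open WeierstrassCurve Literature.NumberTheory.EllipticCurves
  Literature.NumberTheory.EllipticCurves.ModularForms
  Literature.NumberTheory.EllipticCurves.Rank1Residual
  Summit.BirchSwinnertonDyer.Rank1Residual
  Summit.BirchSwinnertonDyer.Rank1Residual.ManinAdditive

/-- **STUB 3 `stub_upperAnchor` (registered signature verbatim) GRANTED Kato's Néron integrality
alone**: F′ (`kato_neron_isIntegral_twistedSymbolSum_of_additive`, `p > 7`) and F″
(`kato_neron_isIntegral_twistedSymbolSum_of_additive_five_le`, `p ∈ {5, 7}`), both cite-only. At
`p > 7` the tame-twist certificate `forall_latticeOptimal_not_dvd_c_of_tameTwistL` applies to the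
upper member directly (additive, `W'[p]` irreducible); at `p ∈ {5, 7}` K★ via
`starredOptimalManinUnitFiveSeven_of_kato`. Conditional-result; BSD is not proved by this.
[cite: Kato2004Asterisque, (8.1.3) (p. 180), Thm. 9.7 (p. 189)] [cite: KimNakamura2020, Cor. 2.4]
[cite: KostersPannekoek2017, Thm. 1 and Cor. 2] -/
theorem upperAnchor_of_kato
    (hK7 : kato_neron_isIntegral_twistedSymbolSum_of_additive)
    (hK5 : kato_neron_isIntegral_twistedSymbolSum_of_additive_five_le) :
    exists_isNewformOf →
    ∀ {p : ℕ}, p.Prime → 5 ≤ p →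
    ∀ (W W' : WeierstrassCurve ℚ) [W.IsElliptic] [W.IsGloballyMinimal] [W'.IsElliptic]
      [W'.IsGloballyMinimal] [NeZero (W.conductorNorm ℤ)] [NeZero (W'.conductorNorm ℤ)]
      (u : VariableChange ℚ) (D : ModularParametrizationData W (W.conductorNorm ℤ))
      (D' : ModularParametrizationData W' (W'.conductorNorm ℤ)),
      IsLatticeOptimal D → IsLatticeOptimal D' →
      p ^ 2 ∣ W.conductorNorm ℤ → W'.conductorNorm ℤ = W.conductorNorm ℤ →
      u • W.quadraticTwist ((((-1 : ℤ) ^ (p / 2) * p : ℤ)) : ℚ) = W' →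
      W.HasIrreducibleModPGaloisRep p →
      padicValInt p W'.minimalDiscriminantInt = padicValInt p W.minimalDiscriminantInt + 6 →
      ¬ (p : ℤ) ∣ D'.maninConstant := by
  intro hnf p hp h5 W W' _ _ _ _ _ _ u D D' hD hD' hpN hNN hu hirr hΔ
  by_cases h7 : 7 < p
  · haveI : Fact p.Prime := ⟨hp⟩
    have hd0 : ((((-1 : ℤ) ^ (p / 2) * p : ℤ)) : ℚ) ≠ 0 := by
      rw [upperAnchor_pStar_cast]
      exact mul_ne_zero (pow_ne_zero _ (by norm_num)) (by exact_mod_cast hp.ne_zero)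
    have hW' : Addv W' p :=
      not_good_and_not_mult_of_sq_dvd_conductorNorm W' (by rw [hNN]; exact hpN)
    have hirr' : Irr W' p := (AdditivePotMult.irr_iff_of_model_twist hd0 ⟨u, hu⟩).mpr hirr
    exact ManinFrameResidueProperRTameTwist.forall_latticeOptimal_not_dvd_c_of_tameTwistL hK7 W' h7
      hW' hirr' W' (isIsogenous_self W') D' hD'
  · have h6 : p ≠ 6 := by rintro rfl; exact absurd hp (by decide)
    have h57 : p = 5 ∨ p = 7 := by omega
    exact upperAnchor_fiveSeven_of_starred (starredOptimalManinUnitFiveSeven_of_kato hK5) hnf hp h57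
      W W' u D D' hD hD' hpN hNN hu hirr hΔ

end Summit.BirchSwinnertonDyer.BirchSwinnertonDyer.Theorems

end
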